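import Summits.QuantumFields.YangMills.Theorems.BalabanLadderUVSeamRecColdWallBoxCeiling
import Literature.RepresentationTheory.CompactGroups.UnitaryTrick
import HarnessLib

/-!
# Crux `UVSeamRec` (stmt-QuantumFields-20043), line «coldwall_pure»: the THERMAL EXCESS of the box energy over the classical Dirichlet energy —
# `S_Λ(ζ₀ ∨ η) ≥ kerE^η_{β,Λ}(S_Λ) − #P_Λ (38 + 12 log β)/β` for EVERY exterior `η`, every cube, every competitor `ζ₀`

Helper file (`--supports stmt-QuantumFields-20043`) of the LEAD seat `ym-spine-20043-p1` (gen 11), sequel of `…ColdWallBoxCeiling` (identity exterior: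
`kerE^{𝟙}(S_Λ) ≤ #P_Λ(34 + 6 log β)/β`).  The same Laplace mechanism for an ARBITRARY exterior `η`: the fibre integral `Z_Λ(β; η) = ∫ e^{−β S(ζ ∨ η)} dζ`
is bounded below by the LEFT-TRANSLATE by any competitor `ζ₀` of the link ball of radius `r = 1/β`, on which the action exceeds `S(ζ₀ ∨ η)` by at most
`8√N·r` per plaquette (the plaquette cost is `2√N`-Lipschitz in the Frobenius distance of the holonomy, and the holonomy moves by `≤ 4r`); no calculus,
no Hessian — the price is a constant `3 log β` instead of `(3/2) log β`.

* §1 `norm_map_mul_sub_map_mul_le`, `norm_map_plaquetteHolonomyZd_sub_le`, `abs_cost_sub_cost_le` — unitary-representation bookkeeping: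
  `‖ρ(U_p) − ρ(V_p)‖_F ≤ Σ_{e ∈ p} ‖ρ(U_e) − ρ(V_e)‖_F`, `|cost(a) − cost(b)| ≤ 2√N ‖ρ a − ρ b‖_F`;
* §2 `wilsonBoundaryAction_le_of_forall_norm_sub_le` — `S_Λ(U) ≤ S_Λ(V) + 8√N r · #P_Λ` when `‖ρ(U_e) − ρ(V_e)‖_F ≤ r` for all `e`;
* §3 **`integral_wilsonBoundaryAction_ymSpecification_le`** (general compact `G`, continuous unitary `ρ`, any exterior `η`, competitor `ζ₀`, `β > 0`, `r > 0`):
  `∫ S_Λ dγ_Λ(·|η) ≤ S_Λ(ζ₀ ∨ η) + 8√N r #P_Λ − #Λ log φ_ρ(r)/β`;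
* §4 **`kerE_wilsonBoundaryAction_le_of_competitor`** (`SU(2)`, crux letters): for every cube `(c, b)`, exterior `η`, competitor `ζ₀`, `β ≥ 1`:
  `kerE^η_{β,(c,b)}(S_Λ) ≤ S_Λ(ζ₀ ∨ η) + #P_Λ (38 + 12 log β)/β`; with the trivial floor `kerE^η(S_Λ) ≥ min S_Λ(· ∨ η)`
  (`le_kerE_wilsonBoundaryAction_of_isMin`), the mean box energy under ANY exterior is its classical Dirichlet minimum up to `#P_Λ(38 + 12 log β)/β`:
  the BOX-SUMMED form of the cold-wall-referenced classical split («quantum energy = classical energy + thermal `O(log β/β)` per plaquette»), for all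
  `η` and all cubes — a rung under `stub_coldWallSplit` (whose content is the same at the CENTRE plaquette with tolerance `A₂C₁/R⁴`).

HONEST FRAMING: elementary one-box Laplace bounds; nothing of E0′, NT or the gap; not Clay.
-/

open MeasureTheory Finset
open scoped ENNReal Matrix Matrix.Norms.Frobenius
open Literature.MathematicalPhysics.QuantumFieldTheory (haarProbability LatticeRep norm_mul_sub_one_le_of_mem_unitaryGroup
  sub_re_trace_eq_half_norm_sub_one_sq)
open Literature.MathematicalPhysics.QuantumLattice
open Literature.Probability.LatticeModels (glueWith glueWith_apply_mem glueWith_apply_not_mem)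
open Summit.QuantumFields.YangMills.Cruxes.OSLegsFromFemtoAndGap.DlrCollarTransfer

noncomputable section

namespace Summit.QuantumFields.YangMills.Cruxes.UVSeamRec.ClassicalResponse.ThermalFloor

/-! ### §1 Unitary bookkeeping -/

section Unitary

variable {N : ℕ} {G : Type*} [Group G] (ρ : G →* Matrix (Fin N) (Fin N) ℂ)

/-- `‖ρ(ab) − ρ(a'b')‖_F ≤ ‖ρ a − ρ a'‖_F + ‖ρ b − ρ b'‖_F` for a unitary representation (`ρ(ab) − ρ(a'b') = (ρa − ρa')ρb + ρa'(ρb − ρb')` and the Frobenius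
norm is unitarily invariant). [cite: HornJohnson2013, Thm 2.2.2] -/
theorem norm_map_mul_sub_map_mul_le (hρU : ∀ g, ρ g ∈ Matrix.unitaryGroup (Fin N) ℂ) (a a' b b' : G) :
    ‖ρ (a * b) - ρ (a' * b')‖ ≤ ‖ρ a - ρ a'‖ + ‖ρ b - ρ b'‖ := by
  have h1 : ρ (a * b) - ρ (a' * b') = (ρ a - ρ a') * ρ b + ρ a' * (ρ b - ρ b') := by
    rw [map_mul, map_mul, Matrix.sub_mul, Matrix.mul_sub]; abel
  have h2 : ‖(ρ a - ρ a') * ρ b‖ = ‖ρ a - ρ a'‖ := Matrix.frobenius_norm_mul_unitaryGroup (ρ a - ρ a') ⟨ρ b, hρU b⟩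
  have h3 : ‖ρ a' * (ρ b - ρ b')‖ = ‖ρ b - ρ b'‖ := Matrix.frobenius_norm_unitaryGroup_mul ⟨ρ a', hρU a'⟩ (ρ b - ρ b')
  calc ‖ρ (a * b) - ρ (a' * b')‖ = ‖(ρ a - ρ a') * ρ b + ρ a' * (ρ b - ρ b')‖ := by rw [h1]
    _ ≤ ‖(ρ a - ρ a') * ρ b‖ + ‖ρ a' * (ρ b - ρ b')‖ := norm_add_le _ _
    _ = ‖ρ a - ρ a'‖ + ‖ρ b - ρ b'‖ := by rw [h2, h3]

/-- `‖ρ(a⁻¹) − ρ(b⁻¹)‖_F = ‖ρ a − ρ b‖_F` for a unitary representation (`ρ(a⁻¹) − ρ(b⁻¹) = ρ(a⁻¹)(ρ b − ρ a)ρ(b⁻¹)`). [cite: HornJohnson2013, Thm 2.2.2] -/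
theorem norm_map_inv_sub_map_inv (hρU : ∀ g, ρ g ∈ Matrix.unitaryGroup (Fin N) ℂ) (a b : G) :
    ‖ρ a⁻¹ - ρ b⁻¹‖ = ‖ρ a - ρ b‖ := by
  have e1 : ρ a⁻¹ * ρ b * ρ b⁻¹ = ρ a⁻¹ := by rw [mul_assoc, ← map_mul, mul_inv_cancel, map_one, mul_one]
  have e2 : ρ a⁻¹ * ρ a * ρ b⁻¹ = ρ b⁻¹ := by rw [← map_mul, inv_mul_cancel, map_one, one_mul]
  have h1 : ρ a⁻¹ - ρ b⁻¹ = ρ a⁻¹ * (ρ b - ρ a) * ρ b⁻¹ := by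
    rw [Matrix.mul_sub, Matrix.sub_mul, e1, e2]
  rw [h1, Matrix.frobenius_norm_mul_unitaryGroup _ ⟨ρ b⁻¹, hρU _⟩, Matrix.frobenius_norm_unitaryGroup_mul ⟨ρ a⁻¹, hρU _⟩, norm_sub_rev]

/-- **The holonomy moves by at most the sum of the link displacements**: if `‖ρ(U_e) − ρ(V_e)‖_F ≤ r` for every link, then `‖ρ(U_p) − ρ(V_p)‖_F ≤ 4r`
for every plaquette `p` of `ℤ^d`. [cite: HornJohnson2013, Thm 2.2.2] -/
theorem norm_map_plaquetteHolonomyZd_sub_le {d : ℕ} (hρU : ∀ g, ρ g ∈ Matrix.unitaryGroup (Fin N) ℂ) {r : ℝ} {U V : LGConfig d G}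
    (hUV : ∀ e, ‖ρ (U e) - ρ (V e)‖ ≤ r) (x : Fin d → ℤ) (i j : Fin d) :
    ‖ρ (plaquetteHolonomyZd U x i j) - ρ (plaquetteHolonomyZd V x i j)‖ ≤ 4 * r := by
  unfold plaquetteHolonomyZd
  have h3 : ‖ρ (U (x + Pi.single j 1, i))⁻¹ - ρ (V (x + Pi.single j 1, i))⁻¹‖ ≤ r := by
    rw [norm_map_inv_sub_map_inv ρ hρU]; exact hUV _
  have h4 : ‖ρ (U (x, j))⁻¹ - ρ (V (x, j))⁻¹‖ ≤ r := by rw [norm_map_inv_sub_map_inv ρ hρU]; exact hUV _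
  calc ‖ρ (U (x, i) * U (x + Pi.single i 1, j) * (U (x + Pi.single j 1, i))⁻¹ * (U (x, j))⁻¹) -
        ρ (V (x, i) * V (x + Pi.single i 1, j) * (V (x + Pi.single j 1, i))⁻¹ * (V (x, j))⁻¹)‖
      ≤ ‖ρ (U (x, i) * U (x + Pi.single i 1, j) * (U (x + Pi.single j 1, i))⁻¹) -
          ρ (V (x, i) * V (x + Pi.single i 1, j) * (V (x + Pi.single j 1, i))⁻¹)‖ + ‖ρ (U (x, j))⁻¹ - ρ (V (x, j))⁻¹‖ :=
        norm_map_mul_sub_map_mul_le ρ hρU _ _ _ _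
    _ ≤ ‖ρ (U (x, i) * U (x + Pi.single i 1, j)) - ρ (V (x, i) * V (x + Pi.single i 1, j))‖ +
          ‖ρ (U (x + Pi.single j 1, i))⁻¹ - ρ (V (x + Pi.single j 1, i))⁻¹‖ + ‖ρ (U (x, j))⁻¹ - ρ (V (x, j))⁻¹‖ := by
        gcongr; exact norm_map_mul_sub_map_mul_le ρ hρU _ _ _ _
    _ ≤ ‖ρ (U (x, i)) - ρ (V (x, i))‖ + ‖ρ (U (x + Pi.single i 1, j)) - ρ (V (x + Pi.single i 1, j))‖ +
          ‖ρ (U (x + Pi.single j 1, i))⁻¹ - ρ (V (x + Pi.single j 1, i))⁻¹‖ + ‖ρ (U (x, j))⁻¹ - ρ (V (x, j))⁻¹‖ := by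
        gcongr; exact norm_map_mul_sub_map_mul_le ρ hρU _ _ _ _
    _ ≤ r + r + r + r := by gcongr <;> exact hUV _
    _ = 4 * r := by ring

variable [TopologicalSpace G] [CompactSpace G] [IsTopologicalGroup G]

/-- **The plaquette cost is `2√N`-Lipschitz in the Frobenius distance of the holonomy**: for a continuous unitary representation,
`|(N − Re tr ρ a) − (N − Re tr ρ b)| ≤ 2√N ‖ρ a − ρ b‖_F` (`N − Re tr ρ g = ‖ρ g − 1‖_F²/2` and `‖ρ g − 1‖_F ≤ 2√N`). [cite: HornJohnson2013, Thm 2.2.2] -/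
theorem abs_cost_sub_cost_le (hρ : Continuous ρ) (hρU : ∀ g, ρ g ∈ Matrix.unitaryGroup (Fin N) ℂ) (a b : G) :
    |((N : ℝ) - (ρ a).trace.re) - ((N : ℝ) - (ρ b).trace.re)| ≤ 2 * Real.sqrt N * ‖ρ a - ρ b‖ := by
  have hsq : ∀ g : G, ‖ρ g - 1‖ ≤ 2 * Real.sqrt N := by
    intro g
    have h1 : (N : ℝ) - (ρ g).trace.re = ‖ρ g - 1‖ ^ 2 / 2 := sub_re_trace_eq_half_norm_sub_one_sq (hρU g)
    have h2 := abs_le.1 (Literature.RepresentationTheory.CompactGroups.CompactGroup.abs_re_trace_le_card ρ hρ g)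
    simp only [Fintype.card_fin] at h2
    have h3 : ‖ρ g - 1‖ ^ 2 ≤ (2 * Real.sqrt N) ^ 2 := by
      rw [mul_pow, Real.sq_sqrt (Nat.cast_nonneg N)]; nlinarith [h2.1]
    exact (pow_le_pow_iff_left₀ (norm_nonneg _) (by positivity) two_ne_zero).1 h3
  rw [sub_re_trace_eq_half_norm_sub_one_sq (hρU a), sub_re_trace_eq_half_norm_sub_one_sq (hρU b)]
  have hd : |‖ρ a - 1‖ - ‖ρ b - 1‖| ≤ ‖ρ a - ρ b‖ := by
    have := abs_norm_sub_norm_le (ρ a - 1) (ρ b - 1)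
    rwa [sub_sub_sub_cancel_right] at this
  have hid : ‖ρ a - 1‖ ^ 2 / 2 - ‖ρ b - 1‖ ^ 2 / 2 = (‖ρ a - 1‖ - ‖ρ b - 1‖) * ((‖ρ a - 1‖ + ‖ρ b - 1‖) / 2) := by ring
  rw [hid, abs_mul]
  have hs : |(‖ρ a - 1‖ + ‖ρ b - 1‖) / 2| ≤ 2 * Real.sqrt N := by
    rw [abs_of_nonneg (by positivity)]
    linarith [hsq a, hsq b]
  calc |‖ρ a - 1‖ - ‖ρ b - 1‖| * |(‖ρ a - 1‖ + ‖ρ b - 1‖) / 2| ≤ ‖ρ a - ρ b‖ * (2 * Real.sqrt N) :=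
        mul_le_mul hd hs (abs_nonneg _) (norm_nonneg _)
    _ = 2 * Real.sqrt N * ‖ρ a - ρ b‖ := by ring

/-! ### §2 The boundary action along a ball displacement -/

/-- **`S_Λ(U) ≤ S_Λ(V) + 8√N r · #P_Λ` when every link of `U` is within Frobenius distance `r` of the corresponding link of `V`.** [folklore] -/
theorem wilsonBoundaryAction_le_of_forall_norm_sub_le (hρ : Continuous ρ) (hρU : ∀ g, ρ g ∈ Matrix.unitaryGroup (Fin N) ℂ)
    (Λ : Finset (ZdEdge 4)) {r : ℝ} {U V : LGConfig 4 G} (hUV : ∀ e, ‖ρ (U e) - ρ (V e)‖ ≤ r) :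
    wilsonBoundaryAction ρ Λ U ≤ wilsonBoundaryAction ρ Λ V + 8 * Real.sqrt N * r * (plaquettesTouching Λ).card := by
  unfold wilsonBoundaryAction
  have hterm : ∀ p ∈ plaquettesTouching Λ,
      ((N : ℝ) - plaquetteObs ρ p.1 p.2.1.1 p.2.1.2 U) ≤ ((N : ℝ) - plaquetteObs ρ p.1 p.2.1.1 p.2.1.2 V) + 8 * Real.sqrt N * r := by
    intro p _
    unfold plaquetteObs
    have h1 := abs_cost_sub_cost_le ρ hρ hρU (plaquetteHolonomyZd U p.1 p.2.1.1 p.2.1.2) (plaquetteHolonomyZd V p.1 p.2.1.1 p.2.1.2)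
    have h2 := norm_map_plaquetteHolonomyZd_sub_le ρ hρU hUV p.1 p.2.1.1 p.2.1.2
    have h3 := (abs_le.1 h1).2
    have h4 : 2 * Real.sqrt N * ‖ρ (plaquetteHolonomyZd U p.1 p.2.1.1 p.2.1.2) - ρ (plaquetteHolonomyZd V p.1 p.2.1.1 p.2.1.2)‖ ≤
        2 * Real.sqrt N * (4 * r) := mul_le_mul_of_nonneg_left h2 (by positivity)
    linarith
  calc ∑ p ∈ plaquettesTouching Λ, ((N : ℝ) - plaquetteObs ρ p.1 p.2.1.1 p.2.1.2 U)
      ≤ ∑ p ∈ plaquettesTouching Λ, (((N : ℝ) - plaquetteObs ρ p.1 p.2.1.1 p.2.1.2 V) + 8 * Real.sqrt N * r) := Finset.sum_le_sum hterm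
    _ = _ := by rw [Finset.sum_add_distrib, Finset.sum_const, nsmul_eq_mul]; ring

end Unitary

/-! ### §3 The thermal excess, general compact group -/

section General

variable {N : ℕ} {G : Type*} [Group G] [TopologicalSpace G] [IsTopologicalGroup G] [CompactSpace G] [MeasurableSpace G]
  [BorelSpace G] [SecondCountableTopology G] (ρ : G →* Matrix (Fin N) (Fin N) ℂ)

/-- **THE THERMAL EXCESS OF THE BOX ENERGY (general compact gauge group, every exterior).**  For a continuous unitary representation `ρ`, a finite link set
`Λ` of `ℤ⁴`, ANY exterior `η`, ANY competitor `ζ₀ ∈ G^Λ`, `β > 0` and `r > 0`: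
`∫ S_Λ dγ_Λ(·|η) ≤ S_Λ(ζ₀ ∨ η) + 8√N r #P_Λ − #Λ · log φ_ρ(r)/β` — Gibbs–Jensen on the fibre, and the fibre integral bounded below by the left-translate
`ζ₀ · Ball^Λ` of the link ball (product Haar is left invariant), on which the action is at most `S_Λ(ζ₀ ∨ η) + 8√N r #P_Λ`.
[cite: FriedliVelenik2017, Lemma 3.5 (p. 94), App. B.8.1] -/
theorem integral_wilsonBoundaryAction_ymSpecification_le (hρ : Continuous ρ) (hρU : ∀ g, ρ g ∈ Matrix.unitaryGroup (Fin N) ℂ)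
    (Λ : Finset (ZdEdge 4)) (η : LGConfig 4 G) (ζ₀ : ↥Λ → G) {β : ℝ} (hβ : 0 < β) {r : ℝ} (hr : 0 < r) :
    ∫ U, wilsonBoundaryAction ρ Λ U ∂(ymSpecification (d := 4) ρ β Λ η) ≤
      wilsonBoundaryAction ρ Λ (glueWith Λ ζ₀ η) + 8 * Real.sqrt N * r * (plaquettesTouching Λ).card -
        Λ.card * Real.log ((haarProbability G).real {g : G | ‖ρ g - 1‖ ≤ r}) / β := by
  classical
  set π : Measure (↥Λ → G) := Measure.pi fun _ : ↥Λ => haarProbability G with hπ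
  haveI hprob : IsProbabilityMeasure (haarProbability G) :=
    ⟨by simpa [haarProbability] using Measure.haarMeasure_self (G := G) (K₀ := ⊤)⟩
  haveI : IsProbabilityMeasure π := by rw [hπ]; infer_instance
  set S : (↥Λ → G) → ℝ := fun ζ => wilsonBoundaryAction ρ Λ (glueWith Λ ζ η) with hSdef
  have hgl : Continuous fun ζ : ↥Λ → G => glueWith Λ ζ η :=
    (continuous_glueWith_prod Λ).comp (Continuous.prodMk continuous_const continuous_id)
  have hSc : Continuous S := (continuous_wilsonBoundaryAction ρ hρ Λ).comp hgl
  obtain ⟨C, hC⟩ : ∃ C, ∀ ζ, |S ζ| ≤ C := by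
    obtain ⟨ζ₁, -, hζ₁⟩ := isCompact_univ.exists_isMaxOn Set.univ_nonempty (continuous_abs.comp hSc).continuousOn
    exact ⟨|S ζ₁|, fun ζ => hζ₁ (Set.mem_univ ζ)⟩
  rw [integral_ymSpecification ρ hρ β Λ (continuous_wilsonBoundaryAction ρ hρ Λ).measurable η]
  change (∫ ζ, S ζ * Real.exp (-β * S ζ) ∂π) / (∫ ζ, Real.exp (-β * S ζ) ∂π) ≤ _
  have hJ := mul_gibbsMean_le_neg_log π hSc.measurable hC β
  -- the translated link ball
  set Ball : Set G := {g : G | ‖ρ g - 1‖ ≤ r} with hBall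
  have hBallm : MeasurableSet Ball :=
    (isClosed_le ((continuous_norm.comp (hρ.sub continuous_const))) continuous_const).measurableSet
  set B : Set (↥Λ → G) := Set.pi Set.univ fun _ : ↥Λ => Ball with hB
  have hBm : MeasurableSet B := MeasurableSet.univ_pi fun _ => hBallm
  set A : Set (↥Λ → G) := (fun ζ => ζ₀⁻¹ * ζ) ⁻¹' B with hA
  have hAm : MeasurableSet A := (measurable_const_mul _) hBm
  set ε : ℝ := S ζ₀ + 8 * Real.sqrt N * r * (plaquettesTouching Λ).card with hε
  have hSA : ∀ ζ ∈ A, S ζ ≤ ε := by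
    intro ζ hζ
    have hδ : ∀ e : ↥Λ, ‖ρ ((ζ₀ e)⁻¹ * ζ e) - 1‖ ≤ r := fun e => hζ e (Set.mem_univ _)
    have hUV : ∀ e, ‖ρ (glueWith Λ ζ η e) - ρ (glueWith Λ ζ₀ η e)‖ ≤ r := by
      intro e
      by_cases he : e ∈ Λ
      · rw [glueWith_apply_mem _ _ _ he, glueWith_apply_mem _ _ _ he]
        have h1 : ρ (ζ ⟨e, he⟩) - ρ (ζ₀ ⟨e, he⟩) = ρ (ζ₀ ⟨e, he⟩) * (ρ ((ζ₀ ⟨e, he⟩)⁻¹ * ζ ⟨e, he⟩) - 1) := by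
          rw [map_mul, Matrix.mul_sub, Matrix.mul_one, ← Matrix.mul_assoc, ← map_mul, mul_inv_cancel, map_one, Matrix.one_mul]
        rw [h1, Matrix.frobenius_norm_unitaryGroup_mul ⟨ρ (ζ₀ ⟨e, he⟩), hρU _⟩]
        exact hδ ⟨e, he⟩
      · rw [glueWith_apply_not_mem _ _ _ he, glueWith_apply_not_mem _ _ _ he, sub_self, norm_zero]; exact hr.le
    exact wilsonBoundaryAction_le_of_forall_norm_sub_le ρ hρ hρU Λ hUV
  set φ : ℝ := (haarProbability G).real Ball with hφdef
  have hφpos : 0 < φ := by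
    haveI : (haarProbability G).IsOpenPosMeasure := by unfold haarProbability; infer_instance
    have hopen : IsOpen {g : G | ‖ρ g - 1‖ < r} := isOpen_lt (continuous_norm.comp (hρ.sub continuous_const)) continuous_const
    have hne : ({g : G | ‖ρ g - 1‖ < r}).Nonempty := ⟨1, by simpa using hr⟩
    have hpos := hopen.measure_pos (haarProbability G) hne
    have hsub : {g : G | ‖ρ g - 1‖ < r} ⊆ Ball := fun g (hg : _ < r) => le_of_lt hg
    exact ENNReal.toReal_pos (ne_of_gt (hpos.trans_le (measure_mono hsub))) (measure_ne_top _ _)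
  have hπA : π.real A = φ ^ Λ.card := by
    rw [measureReal_def, hA, measure_preimage_mul, hB, hπ, Measure.pi_pi, Finset.prod_const, Finset.card_univ, Fintype.card_coe,
      ENNReal.toReal_pow, ← measureReal_def]
  have hZlow : Real.exp (-β * ε) * φ ^ Λ.card ≤ ∫ ζ, Real.exp (-β * S ζ) ∂π := by
    have hind : ∫ ζ, A.indicator (fun _ => Real.exp (-β * ε)) ζ ∂π = Real.exp (-β * ε) * π.real A := by
      rw [integral_indicator_const _ hAm, smul_eq_mul, mul_comm]
    rw [← hπA, ← hind]
    have hint : Integrable (fun ζ => Real.exp (-β * S ζ)) π :=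
      Integrable.of_bound (Real.measurable_exp.comp (hSc.measurable.const_mul _)).aestronglyMeasurable (Real.exp (|β| * C))
        (ae_of_all _ fun ζ => by
          rw [Real.norm_eq_abs, Real.abs_exp]
          refine Real.exp_le_exp.2 ?_
          have h1 : |(-β) * S ζ| ≤ |β| * C := by rw [abs_mul, abs_neg]; gcongr; exact hC ζ
          exact (le_abs_self _).trans h1)
    refine integral_mono ((integrable_const _).indicator hAm) hint fun ζ => ?_
    by_cases hζ : ζ ∈ A
    · rw [Set.indicator_of_mem hζ]
      refine Real.exp_le_exp.2 ?_
      have := hSA ζ hζ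
      nlinarith
    · rw [Set.indicator_of_notMem hζ]
      exact (Real.exp_pos _).le
  have hlog : -Real.log (∫ ζ, Real.exp (-β * S ζ) ∂π) ≤ β * ε - Λ.card * Real.log φ := by
    have h := Real.log_le_log (mul_pos (Real.exp_pos _) (pow_pos hφpos _)) hZlow
    rw [Real.log_mul (Real.exp_pos _).ne' (pow_pos hφpos _).ne', Real.log_exp, Real.log_pow] at h
    linarith
  have hkey : β * ((∫ ζ, S ζ * Real.exp (-β * S ζ) ∂π) / ∫ ζ, Real.exp (-β * S ζ) ∂π) ≤ β * (ε - Λ.card * Real.log φ / β) := by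
    rw [mul_sub, mul_div_cancel₀ _ hβ.ne']
    exact hJ.trans hlog
  have := le_of_mul_le_mul_left hkey hβ
  rw [hε] at this
  linarith

/-- **Trivial floor**: if `ζ₀` MINIMISES `S_Λ(· ∨ η)` then `S_Λ(ζ₀ ∨ η) ≤ ∫ S_Λ dγ_Λ(·|η)` (the kernel is a probability measure on the fibre glued with `η`).
[folklore] -/
theorem le_integral_wilsonBoundaryAction_ymSpecification_of_isMin (hρ : Continuous ρ) (Λ : Finset (ZdEdge 4)) (η : LGConfig 4 G) {ζ₀ : ↥Λ → G}
    (hmin : ∀ ζ : ↥Λ → G, wilsonBoundaryAction ρ Λ (glueWith Λ ζ₀ η) ≤ wilsonBoundaryAction ρ Λ (glueWith Λ ζ η)) (β : ℝ) :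
    wilsonBoundaryAction ρ Λ (glueWith Λ ζ₀ η) ≤ ∫ U, wilsonBoundaryAction ρ Λ U ∂(ymSpecification (d := 4) ρ β Λ η) := by
  classical
  set π : Measure (↥Λ → G) := Measure.pi fun _ : ↥Λ => haarProbability G with hπ
  haveI hprob : IsProbabilityMeasure (haarProbability G) :=
    ⟨by simpa [haarProbability] using Measure.haarMeasure_self (G := G) (K₀ := ⊤)⟩
  haveI : IsProbabilityMeasure π := by rw [hπ]; infer_instance
  set S : (↥Λ → G) → ℝ := fun ζ => wilsonBoundaryAction ρ Λ (glueWith Λ ζ η) with hSdef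
  have hgl : Continuous fun ζ : ↥Λ → G => glueWith Λ ζ η :=
    (continuous_glueWith_prod Λ).comp (Continuous.prodMk continuous_const continuous_id)
  have hSc : Continuous S := (continuous_wilsonBoundaryAction ρ hρ Λ).comp hgl
  obtain ⟨C, hC⟩ : ∃ C, ∀ ζ, |S ζ| ≤ C := by
    obtain ⟨ζ₁, -, hζ₁⟩ := isCompact_univ.exists_isMaxOn Set.univ_nonempty (continuous_abs.comp hSc).continuousOn
    exact ⟨|S ζ₁|, fun ζ => hζ₁ (Set.mem_univ ζ)⟩
  rw [integral_ymSpecification ρ hρ β Λ (continuous_wilsonBoundaryAction ρ hρ Λ).measurable η]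
  change S ζ₀ ≤ (∫ ζ, S ζ * Real.exp (-β * S ζ) ∂π) / (∫ ζ, Real.exp (-β * S ζ) ∂π)
  have hem : Measurable fun ζ => Real.exp (-β * S ζ) := Real.measurable_exp.comp (hSc.measurable.const_mul _)
  have heb : ∀ ζ, |Real.exp (-β * S ζ)| ≤ Real.exp (|β| * C) := fun ζ => by
    rw [Real.abs_exp]
    refine Real.exp_le_exp.2 ((le_abs_self _).trans ?_)
    rw [abs_mul, abs_neg]; gcongr; exact hC ζ
  have hint : Integrable (fun ζ => Real.exp (-β * S ζ)) π :=
    Integrable.of_bound hem.aestronglyMeasurable _ (ae_of_all _ fun ζ => by rw [Real.norm_eq_abs]; exact heb ζ)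
  have hint2 : Integrable (fun ζ => S ζ * Real.exp (-β * S ζ)) π :=
    Integrable.of_bound (hSc.measurable.mul hem).aestronglyMeasurable (C * Real.exp (|β| * C))
      (ae_of_all _ fun ζ => by
        rw [Real.norm_eq_abs, abs_mul]
        exact mul_le_mul (hC ζ) (heb ζ) (abs_nonneg _) ((abs_nonneg _).trans (hC ζ)))
  have hZpos : 0 < ∫ ζ, Real.exp (-β * S ζ) ∂π := integral_exp_pos hint
  rw [le_div_iff₀ hZpos, ← integral_const_mul]
  exact integral_mono (hint.const_mul _) hint2 fun ζ => mul_le_mul_of_nonneg_right (hmin ζ) (Real.exp_pos _).le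

end General

/-! ### §4 The `SU(2)` cube, crux letters -/

section SU2

/-- **THE THERMAL EXCESS for `SU(2)` (crux letters).**  For every cube `(c, b)`, EVERY exterior `η`, every competitor `ζ₀` on the interior links and `β ≥ 1`:
`kerE^η_{β,(c,b)}(S_Λ) ≤ S_Λ(ζ₀ ∨ η) + #P_Λ · (38 + 12 log β)/β` (`r = 1/β`, sharp small ball `φ(r) ≥ r³/600`, `#Λ ≤ 4 #P_Λ`, `8√2 ≤ 12`) — in particular, with
`ζ₀` a minimiser, the mean box energy is the classical Dirichlet minimum up to `#P_Λ(38 + 12 log β)/β`, uniformly in the exterior and the cube. [folklore] -/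
theorem kerE_wilsonBoundaryAction_le_of_competitor (c : Fin 4 → ℤ) (b : ℕ) (η : LGConfig 4 (Matrix.specialUnitaryGroup (Fin 2) ℂ))
    (ζ₀ : ↥(cubeEdges c b) → Matrix.specialUnitaryGroup (Fin 2) ℂ) {β : ℝ} (hβ : 1 ≤ β) :
    kerE (Matrix.specialUnitaryGroup (Fin 2) ℂ) (fundamentalLatticeRep 2) β c b η
        (wilsonBoundaryAction (fundamentalRep (Fin 2)) (cubeEdges c b)) ≤
      wilsonBoundaryAction (fundamentalRep (Fin 2)) (cubeEdges c b) (glueWith (cubeEdges c b) ζ₀ η) +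
        (plaquettesTouching (cubeEdges c b)).card * ((38 + 12 * Real.log β) / β) := by
  haveI : SecondCountableTopology (Matrix.specialUnitaryGroup (Fin 2) ℂ) := secondCountableTopology_su2
  have hβ0 : 0 < β := by linarith
  have hr0 : 0 < 1 / β := by positivity
  have hr1 : 1 / β ≤ 1 := by rw [div_le_one hβ0]; exact hβ
  have hφ := haarProbability_real_frobeniusBall_ge_su2_sharp hr0 hr1
  have h := integral_wilsonBoundaryAction_ymSpecification_le (fundamentalRep (Fin 2)) (continuous_fundamentalRep (Fin 2))
    fundamentalRep_mem_unitaryGroup (cubeEdges c b) η ζ₀ hβ0 hr0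
  have hN2 : Real.sqrt ((2 : ℕ) : ℝ) = Real.sqrt 2 := by norm_num
  rw [hN2] at h
  unfold kerE
  refine h.trans ?_
  set P : ℝ := ((plaquettesTouching (cubeEdges c b)).card : ℝ) with hPdef
  set L : ℝ := ((cubeEdges c b).card : ℝ) with hLdef
  set S₀ : ℝ := wilsonBoundaryAction (fundamentalRep (Fin 2)) (cubeEdges c b) (glueWith (cubeEdges c b) ζ₀ η) with hS₀
  set φ : ℝ := (haarProbability (Matrix.specialUnitaryGroup (Fin 2) ℂ)).real
      {g : Matrix.specialUnitaryGroup (Fin 2) ℂ | ‖fundamentalRep (Fin 2) g - 1‖ ≤ 1 / β} with hφdef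
  have hL : 0 ≤ L := Nat.cast_nonneg _
  have hP : 0 ≤ P := Nat.cast_nonneg _
  have hLP : L ≤ 4 * P := by
    rw [hPdef, hLdef]; exact_mod_cast card_le_four_mul_card_plaquettesTouching (cubeEdges c b)
  have hφpos : 0 < φ := lt_of_lt_of_le (by positivity) hφ
  -- `−log φ ≤ 3 log β + 13/2`
  have hlogφ : -Real.log φ ≤ 3 * Real.log β + 13 / 2 := by
    have h1 := Real.log_le_log (by positivity) hφ
    rw [Real.log_div (by positivity) (by norm_num), Real.log_pow, one_div, Real.log_inv] at h1
    have h600 : Real.log 600 ≤ 13 / 2 := by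
      rw [Real.log_le_iff_le_exp (by norm_num)]
      have he : (2.71828 : ℝ) < Real.exp 1 := lt_trans (by norm_num) Real.exp_one_gt_d9
      have h6 : Real.exp (13 / 2) = Real.exp 1 ^ 6 * Real.exp (1 / 2) := by
        rw [← Real.exp_nat_mul, ← Real.exp_add]; norm_num
      have h25 : (1 : ℝ) + 1 / 2 ≤ Real.exp (1 / 2) := by
        have := Real.add_one_le_exp (1 / 2 : ℝ); linarith
      have hp : (2.71828 : ℝ) ^ 6 < Real.exp 1 ^ 6 := by gcongr
      have h403 : (403 : ℝ) < Real.exp 1 ^ 6 := lt_trans (by norm_num) hp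
      rw [h6]
      nlinarith [Real.exp_pos (1 / 2 : ℝ), h403, h25]
    push_cast at h1
    linarith
  -- `8√2 ≤ 12`
  have hs2 : Real.sqrt 2 ≤ 3 / 2 := by
    rw [Real.sqrt_le_left (by norm_num)]; norm_num
  have hlog0 : 0 ≤ Real.log β := Real.log_nonneg hβ
  -- assemble: everything over `β`
  have e1 : S₀ + 8 * Real.sqrt 2 * (1 / β) * P - L * Real.log φ / β = S₀ + (8 * Real.sqrt 2 * P + L * (-Real.log φ)) / β := by
    field_simp; ring
  rw [e1, mul_div, add_le_add_iff_left]
  refine div_le_div_of_nonneg_right ?_ hβ0.le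
  have h1 : L * (-Real.log φ) ≤ 4 * P * (3 * Real.log β + 13 / 2) :=
    mul_le_mul hLP hlogφ (by linarith [mul_le_mul_of_nonneg_left hlogφ hL, neg_nonneg.2 (Real.log_nonpos hφpos.le
      (measureReal_le_one.trans le_rfl))]) (by positivity)
  have h2 : 8 * Real.sqrt 2 * P ≤ 12 * P := by
    have h8 : 8 * Real.sqrt 2 ≤ 12 := by linarith [hs2]
    exact mul_le_mul_of_nonneg_right h8 hP
  nlinarith

/-- **Trivial floor (crux letters)**: for a minimiser `ζ₀` of `S_Λ(· ∨ η)`, `S_Λ(ζ₀ ∨ η) ≤ kerE^η_{β,(c,b)}(S_Λ)`. [folklore] -/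
theorem le_kerE_wilsonBoundaryAction_of_isMin (c : Fin 4 → ℤ) (b : ℕ) (η : LGConfig 4 (Matrix.specialUnitaryGroup (Fin 2) ℂ))
    {ζ₀ : ↥(cubeEdges c b) → Matrix.specialUnitaryGroup (Fin 2) ℂ}
    (hmin : ∀ ζ, wilsonBoundaryAction (fundamentalRep (Fin 2)) (cubeEdges c b) (glueWith (cubeEdges c b) ζ₀ η) ≤
      wilsonBoundaryAction (fundamentalRep (Fin 2)) (cubeEdges c b) (glueWith (cubeEdges c b) ζ η)) (β : ℝ) :
    wilsonBoundaryAction (fundamentalRep (Fin 2)) (cubeEdges c b) (glueWith (cubeEdges c b) ζ₀ η) ≤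
      kerE (Matrix.specialUnitaryGroup (Fin 2) ℂ) (fundamentalLatticeRep 2) β c b η
        (wilsonBoundaryAction (fundamentalRep (Fin 2)) (cubeEdges c b)) := by
  haveI : SecondCountableTopology (Matrix.specialUnitaryGroup (Fin 2) ℂ) := secondCountableTopology_su2
  unfold kerE
  exact le_integral_wilsonBoundaryAction_ymSpecification_of_isMin (fundamentalRep (Fin 2)) (continuous_fundamentalRep (Fin 2))
    (cubeEdges c b) η hmin β

end SU2

end Summit.QuantumFields.YangMills.Cruxes.UVSeamRec.ClassicalResponse.ThermalFloor

end
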